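import Summits.BirchSwinnertonDyer.BirchSwinnertonDyer.Theorems.ByReductionTypeAtTwoAdditivePotGoodPrintKrizLi
import Summits.BirchSwinnertonDyer.BirchSwinnertonDyer.Theorems.ByReductionTypeAtTwoAdditivePotGoodPrintKrizLi92b1Base
import Literature.NumberTheory.EllipticCurves.KrizLi2019.Table1RankOneRow92b1
import Mathlib.Tactic.NormNum.LegendreSymbol
import HarnessLib

/-!
# K4 crux `AdditiveRankZeroAtTwo` (19098), children C3″ (22617) / C1″ (22615): THE KRIZ–LI ROAD AT THE RANK-ONE BASE `92b1` OVER `K = ℚ(√−7)` —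
# `BSD(·, 2)` on `{92b1^{(d)}}` (rank ONE) and on the RANK-ZERO companions `{92b1^{(−7d)}}` (`E[2]`-irreducible, additive potentially good:
# C3″ members with BOTH K4 halves), `d ∈ 𝒩(92b1, K)`, `χ_d(−92) = 1`, from the PRINTED Table-1 row `92b1 | −7 | 3 | ✓`
# (`KrizLi2019.table1_row92b1`) BY NAME; witness `d = 29` (`#Ẽ(𝔽₂₉) = 37`): members `92b1^{(29)}` (rank 1), `92b1^{(−203)}` (rank 0)

Cell `bsd-2adic`, seat `bsd-2adic-k4-w2` GEN 7 (prover, explicit unit, no kit); `--supports stmt-BirchSwinnertonDyer-22617 --as helper`.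
HONEST FRAMING (D-0036/D-0054): the generic road (`…PrintKrizLi.lean`, §3: no rank input) instantiated at the RANK-ONE base
`V = 92b1 = [0,0,0,−1,1]` (kernel base data `…PrintKrizLi92b1Base.lean`: `IV` at `2`, `N = 92`, partner `N = 4508`, a point of infinite
order). `r_an(92b1) = 1` is a THEOREM here (Thm 4.3 at `d = 1` gives `≤ 1`; GZK + the kernel point gives `≠ 0`) — so NOTHING is displayed
on the base. The sorting is the mirror image of the rank-zero bases: `92b1^{(d)}` has analytic rank `1` (19099's children) and the
companion `92b1^{(−7d)}` has analytic rank `0` with `BSD(·, 2)`, hence BOTH K4 halves — these are C3″/C1″ members (irreducible `E[2]`,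
additive, `0 ≤ ord₂ j`, non-CM, by the unramified-twist habitat transport). PRINT BY NAME: Kriz–Li Thm 5.1 (2) / Thm 4.3, the Table-1 row,
Creutz–Miller (`BSD(92b1, 2)`, `BSD(92b1^{(−7)}, 2)`: conductors `92`, `4508`), ARS Thm. 2.6, GZK. Closes nothing at the `∀`-level;
nothing booked; BSD is not proved by any of this.

References: [KrizLi2019] Thm 5.1 (2), Thm 4.3, Def 4.1, §6 Ex. 6.1–6.2, Table 1 (row 92b1); [CreutzMiller2012] Thm 1.1; [AgasheRibetStein2006]
Thm 2.6; [Miller2011LMS] Def 1.1; [CremonaAlgorithms1997] Table 1 (92B1); [Marcus1977] Ch. 3 Thm. 25; [SilvermanAEC2009] V.2.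
-/

set_option autoImplicit false
-- the Theorems namespace of this sub repeats the summit name by design (D-0017 nested layout)
set_option linter.dupNamespace false

noncomputable section

open scoped Classical

open WeierstrassCurve NumberField Literature.NumberTheory.EllipticCurves
  Literature.NumberTheory.EllipticCurves.ModularForms
  Literature.NumberTheory.EllipticCurves.Rank1Residual
  Literature.NumberTheory.EllipticCurves.Rank1Residual.Typed
  Literature.NumberTheory.EllipticCurves.AgasheRibetStein2006
  Summit.BirchSwinnertonDyer.Rank1Residual
  Summit.BirchSwinnertonDyer.Rank1Residual.P2

namespace Summit.BirchSwinnertonDyer.BirchSwinnertonDyer.Theorems.AddPotGoodPrint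

/-! ## §1 The Heegner field `K`, `d_K = −7`: `2` and `23` split; Kriz–Li's standing hypotheses at `92b1` -/
section Base92B1Field

/-- **The Heegner hypothesis for `(92b1, K)`, `d_K = −7`**: every prime of `N = 92` splits in `K` (`−7 ≡ 1 (mod 8)`; `(−7/23) = (16/23) = 1`).
[cite: KrizLi2019, Thm. 5.1 hypothesis "K satisfies the Heegner hypothesis for N"] [cite: Marcus1977, Ch. 3 Thm. 25] -/
theorem satisfiesHeegnerHypothesis_92B1 {K : Type} [Field K] [NumberField K] (h2 : Module.finrank ℚ K = 2)
    (hdK : NumberField.discr K = -7) :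
    haveI := isElliptic_92B1
    SatisfiesHeegnerHypothesis ((⟨0, 0, 0, -1, 1⟩ : WeierstrassCurve ℚ).conductorNorm ℤ) K := by
  rw [conductorNorm_92B1, satisfiesHeegnerHypothesis_iff_kronecker _ K h2, hdK]
  intro q hq hqN
  have hq' : q ∣ 2 ^ 2 * 23 := by simpa using hqN
  rcases (Nat.Prime.dvd_mul hq).mp hq' with h | h
  · obtain rfl := (Nat.prime_dvd_prime_iff_eq hq Nat.prime_two).mp (hq.dvd_of_dvd_pow h)
    exact ⟨fun _ => by decide, fun h => absurd rfl h⟩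
  · obtain rfl := (Nat.prime_dvd_prime_iff_eq hq (by norm_num)).mp h
    exact ⟨fun h => absurd h (by norm_num), fun _ => by norm_num⟩

/-- **`E(ℚ)[2] = 0` for `E = 92b1`** in Kriz–Li's shape (`E[2]` irreducible: GEN 6's `irr_two_92B1`).
[cite: KrizLi2019, Thm. 5.1 hypothesis "E(ℚ)[2] = 0"] -/
theorem twoTorsion_92B1 :
    haveI := isElliptic_92B1
    ∀ Q : (⟨0, 0, 0, -1, 1⟩ : WeierstrassCurve ℚ).toAffine.Point, 2 • Q = 0 → Q = 0 :=
  haveI := isElliptic_92B1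
  (X5.O1.irr_two_iff_forall_two_nsmul _).mp irr_two_92B1

/-- **Kriz–Li's local hypotheses at `2` for `E = 92b1`**: `c₂(E)` odd (kernel: type `IV`, `c₂ ∣ 3`) and — `E` being ADDITIVE at `2` — the
Manin constant `Dt.c` of the OPTIMAL datum odd, by print (Agashe–Ribet–Stein Thm. 2.6 / Cremona: `|c| = 1` at level `≤ 130000`, `h26`).
[cite: KrizLi2019, Thm. 5.1 hypotheses "c₂(E) odd; Manin constant odd if additive at 2"] [cite: AgasheRibetStein2006, Thm. 2.6] -/
theorem krizLi_loc_92B1 (h26 : cremona_abs_maninConstant_eq_one_of_level_le)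
    [hN : haveI := isElliptic_92B1; NeZero ((⟨0, 0, 0, -1, 1⟩ : WeierstrassCurve ℚ).conductorNorm ℤ)]
    (Dt : haveI := isElliptic_92B1; ModularParametrizationData (⟨0, 0, 0, -1, 1⟩ : WeierstrassCurve ℚ)
      ((⟨0, 0, 0, -1, 1⟩ : WeierstrassCurve ℚ).conductorNorm ℤ))
    (hopt : haveI := isElliptic_92B1; Zhai2021.IsOptimalDatum (⟨0, 0, 0, -1, 1⟩ : WeierstrassCurve ℚ) Dt) :
    haveI := isElliptic_92B1; haveI : Fact (2 : ℕ).Prime := ⟨Nat.prime_two⟩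
    Odd (((⟨0, 0, 0, -1, 1⟩ : WeierstrassCurve ℚ).baseChange ℚ_[2]).localTamagawaNumber ℤ_[2]) ∧
      (¬ (⟨0, 0, 0, -1, 1⟩ : WeierstrassCurve ℚ).HasGoodReductionAtPrime 2 →
        ¬ (⟨0, 0, 0, -1, 1⟩ : WeierstrassCurve ℚ).HasMultiplicativeReductionAtPrime 2 → Odd Dt.c) := by
  haveI := isElliptic_92B1; haveI := isGloballyMinimal_92B1
  refine ⟨odd_localTamagawaNumber_two_92B1, fun _ _ => ?_⟩
  have hc : ¬ (2 : ℤ) ∣ Dt.c := not_two_dvd_c_of_level_le h26 _ Dt hopt conductorNorm_le_92B1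
  exact Int.not_even_iff_odd.mp fun h => hc (even_iff_two_dvd.mp h)

/-- The partner model `[0,0,0,−49,−343]` IS a model of `92b1^{(d_K)}` for `d_K = −7` (with the identity change of variables).
[cite: SilvermanAEC2009, X.5 Cor. 5.4] -/
theorem partner_92B1 {K : Type} [Field K] [NumberField K] (hdK : NumberField.discr K = -7) :
    ∃ C : VariableChange ℚ, C • (⟨0, 0, 0, -1, 1⟩ : WeierstrassCurve ℚ).quadraticTwist (NumberField.discr K : ℚ) =
      (⟨0, 0, 0, -49, -343⟩ : WeierstrassCurve ℚ) :=
  ⟨1, by rw [one_smul, hdK]; push_cast; exact quadraticTwist_neg7_92B1⟩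

end Base92B1Field

/-! ## §2 THE ROAD AT `92b1` with the (★)-datum DISPLAYED (any `K` with `d_K = −7`) -/
section Road92B1

/-- **`BSD(W′, 2)` at EVERY global minimal `W′ ≅ 92b1^{(d)}` or `≅ 92b1^{(−7d)}`, `d ∈ 𝒩(92b1, K)`, `χ_d(−92) = 1`** — the (★)-datum
(`Dt` OPTIMAL, `H`, `ι`, `P ↦` Heegner point, `j`, (★)) displayed; everything else kernel or by name (Kriz–Li Thm 5.1 (2) + 4.3, Creutz–Miller
on `92` and `4508`, ARS). NO rank input. BSD is not proved by any of this.
[cite: KrizLi2019, Thm. 5.1 (2) and Thm. 4.3] [cite: CreutzMiller2012, Thm. 1.1] [cite: AgasheRibetStein2006, Thm. 2.6] [cite: Miller2011LMS, Def. 1.1] -/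
theorem krizLi_bsdp_two_of_twist_92B1 (hKL : KrizLi2019.thm112_bsdTwo_twist) (h33 : KrizLi2019.thm33_rank_twist)
    (hS31 : bsdTriple_of_analyticRank_le_one_of_conductor_lt) (h26 : cremona_abs_maninConstant_eq_one_of_level_le)
    (K : Type) [Field K] [NumberField K] (hK : IsImaginaryQuadratic K) (hdK : NumberField.discr K = -7)
    [hN : haveI := isElliptic_92B1; NeZero ((⟨0, 0, 0, -1, 1⟩ : WeierstrassCurve ℚ).conductorNorm ℤ)]
    (Dt : haveI := isElliptic_92B1; ModularParametrizationData (⟨0, 0, 0, -1, 1⟩ : WeierstrassCurve ℚ)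
      ((⟨0, 0, 0, -1, 1⟩ : WeierstrassCurve ℚ).conductorNorm ℤ))
    (hopt : haveI := isElliptic_92B1; Zhai2021.IsOptimalDatum (⟨0, 0, 0, -1, 1⟩ : WeierstrassCurve ℚ) Dt)
    (H : haveI := isElliptic_92B1; HeegnerDatum ((⟨0, 0, 0, -1, 1⟩ : WeierstrassCurve ℚ).conductorNorm ℤ) (NumberField.discr K))
    (ι : K →+* ℂ) (P : ((⟨0, 0, 0, -1, 1⟩ : WeierstrassCurve ℚ).baseChange K).toAffine.Point)
    (hP : WeierstrassCurve.Affine.Point.map ι.toRatAlgHom P = heegnerPointComplex Dt H)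
    (j : K →ₐ[ℚ] ℚ_[2]) (hstar : haveI := isGloballyMinimal_92B1; KrizLi2019.AssumptionStar (⟨0, 0, 0, -1, 1⟩ : WeierstrassCurve ℚ) Dt K P j)
    {d : ℤ} (hd : haveI := isGloballyMinimal_92B1; KrizLi2019.InN (⟨0, 0, 0, -1, 1⟩ : WeierstrassCurve ℚ) K d)
    (hsign : haveI := isElliptic_92B1; Int.sign d * jacobiSym ((⟨0, 0, 0, -1, 1⟩ : WeierstrassCurve ℚ).conductorNorm ℤ) d.natAbs = 1)
    (W' : WeierstrassCurve ℚ) [W'.IsElliptic] [W'.IsGloballyMinimal]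
    (hW' : (∃ C : VariableChange ℚ, C • (⟨0, 0, 0, -1, 1⟩ : WeierstrassCurve ℚ).quadraticTwist (d : ℚ) = W') ∨
      (∃ C : VariableChange ℚ, C • (⟨0, 0, 0, -1, 1⟩ : WeierstrassCurve ℚ).quadraticTwist ((d * NumberField.discr K : ℤ) : ℚ) = W')) :
    BSDp W' 2 := by
  haveI := isElliptic_92B1; haveI := isGloballyMinimal_92B1
  haveI := isElliptic_T92B1; haveI := isGloballyMinimal_T92B1
  exact krizLi_bsdp_two_of_twist_of_conductor_lt _ hKL h33 hS31 conductorNorm_lt_5000_92B1 twoTorsion_92B1 K hK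
    (satisfiesHeegnerHypothesis_92B1 hK.1 hdK) Dt H ι P hP j hstar (krizLi_loc_92B1 h26 Dt hopt) (⟨0, 0, 0, -49, -343⟩ : WeierstrassCurve ℚ)
    (partner_92B1 hdK) conductorNorm_lt_5000_T92B1 hd hsign W' hW'

end Road92B1

/-! ## §3 `r_an(92b1) = 1` as a THEOREM; the road BY NAME from the Table-1 row; the sorting for a rank-one base -/
section Road92B1ByName

/-- **`ord_{s=1} L(92b1, s) = 1`** granted Thm 4.3 (`h33`: `≤ 1` at `d = 1`), the Table-1 row (`htab`: the (★)-datum) and GZK (`hGZK`: rank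
`=` analytic rank in analytic rank `≤ 1`): the kernel point `(19/25, −103/125)` of infinite order rules out analytic rank `0`.
[cite: KrizLi2019, Thm. 4.3 and §6 Table 1 (row 92b1, "rank one curves")] [cite: CremonaAlgorithms1997, Table 1 (92B1: r = 1)] -/
theorem analyticRank_92B1 (h33 : KrizLi2019.thm33_rank_twist) (htab : KrizLi2019.table1_row92b1)
    (hGZK : rank_eq_analyticRank_of_analyticRank_le_one) :
    haveI := isElliptic_92B1
    (⟨0, 0, 0, -1, 1⟩ : WeierstrassCurve ℚ).analyticRank = 1 := by
  haveI := isElliptic_92B1; haveI := isGloballyMinimal_92B1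
  haveI : Fact ((-7 : ℤ) < 0) := ⟨by norm_num⟩
  obtain ⟨hIQ, hdisc⟩ := P2.isImaginaryQuadratic_and_discr_of_sq_eq_neg_prime (sqrtField.finrank_eq_two (-7))
    (p := 7) (by norm_num) (by norm_num) (x := sqrtField.r (-7)) (by rw [sqrtField.r_sq']; push_cast; ring)
  obtain ⟨_, Dt, H, ι, P, j, -, hP, hstar⟩ := htab (sqrtField (-7)) hIQ hdisc
  have hle := krizLi_analyticRank_le_one _ h33 twoTorsion_92B1 (sqrtField (-7)) hIQ (satisfiesHeegnerHypothesis_92B1 hIQ.1 hdisc)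
    Dt H ι P hP j hstar
  have hrk := one_le_mordellWeilRank_92B1
  have h := (hGZK _ hle).1
  omega

/-- **`BSD(W′, 2)` at EVERY global minimal `W′ ≅ 92b1^{(d)}` or `≅ 92b1^{(−7d)}`**, `d ∈ 𝒩(92b1, K)`, `χ_d(−92) = 1`, BY NAME from the Table-1
row (no displayed input). [cite: KrizLi2019, Thm. 5.1 (2), Thm. 4.3, §6 Table 1 (row 92b1)] [cite: CreutzMiller2012, Thm. 1.1]
[cite: AgasheRibetStein2006, Thm. 2.6] [cite: Miller2011LMS, Def. 1.1] -/
theorem krizLi_bsdp_two_of_twist_92B1_of_table1 (hKL : KrizLi2019.thm112_bsdTwo_twist) (h33 : KrizLi2019.thm33_rank_twist)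
    (htab : KrizLi2019.table1_row92b1) (hS31 : bsdTriple_of_analyticRank_le_one_of_conductor_lt)
    (h26 : cremona_abs_maninConstant_eq_one_of_level_le)
    (K : Type) [Field K] [NumberField K] (hK : IsImaginaryQuadratic K) (hdK : NumberField.discr K = -7)
    {d : ℤ} (hd : haveI := isGloballyMinimal_92B1; KrizLi2019.InN (⟨0, 0, 0, -1, 1⟩ : WeierstrassCurve ℚ) K d)
    (hsign : haveI := isElliptic_92B1; Int.sign d * jacobiSym ((⟨0, 0, 0, -1, 1⟩ : WeierstrassCurve ℚ).conductorNorm ℤ) d.natAbs = 1)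
    (W' : WeierstrassCurve ℚ) [W'.IsElliptic] [W'.IsGloballyMinimal]
    (hW' : (∃ C : VariableChange ℚ, C • (⟨0, 0, 0, -1, 1⟩ : WeierstrassCurve ℚ).quadraticTwist (d : ℚ) = W') ∨
      (∃ C : VariableChange ℚ, C • (⟨0, 0, 0, -1, 1⟩ : WeierstrassCurve ℚ).quadraticTwist ((-7 * d : ℤ) : ℚ) = W')) :
    BSDp W' 2 := by
  haveI := isElliptic_92B1; haveI := isGloballyMinimal_92B1
  obtain ⟨_, Dt, H, ι, P, j, hopt, hP, hstar⟩ := htab K hK hdK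
  have hdK' : ((d * NumberField.discr K : ℤ) : ℚ) = ((-7 * d : ℤ) : ℚ) := by rw [hdK]; push_cast; ring
  exact krizLi_bsdp_two_of_twist_92B1 hKL h33 hS31 h26 K hK hdK Dt hopt H ι P hP j hstar hd hsign W' (by rw [hdK']; exact hW')

/-- **THE RANK-ZERO COMPANIONS `92b1^{(−7d)}` — C3″ MEMBERS, BY NAME**: at EVERY global minimal `W₂ ≅ 92b1^{(−7d)}`, `d ∈ 𝒩(92b1, K)`,
`χ_d(−92) = 1`: `r_an(W₂) = 0 ∧ Addv W₂ 2 ∧ 0 ≤ ord₂ j(W₂) ∧ ¬CM ∧ Irr W₂ 2 ∧ BSD(W₂, 2) ∧ MissingLowerBoundAt W₂ 2 ∧ MissingUpperBoundAt W₂ 2`.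
No displayed input (the base's analytic rank `1` is `analyticRank_92B1`). By name: Thm 5.1 (2), Thm 4.3, Table-1 row, Creutz–Miller, ARS, GZK.
BSD is not proved by any of this. [cite: KrizLi2019, Thm. 5.1 (2), Thm. 4.3, §6 Table 1 (row 92b1)] [cite: CreutzMiller2012, Thm. 1.1]
[cite: AgasheRibetStein2006, Thm. 2.6] [cite: Miller2011LMS, Def. 1.1] [cite: SilvermanAEC2009, VII.5 and X.5] -/
theorem printFamily92B1_krizLi_rankZeroCompanions (hKL : KrizLi2019.thm112_bsdTwo_twist) (h33 : KrizLi2019.thm33_rank_twist)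
    (htab : KrizLi2019.table1_row92b1) (hS31 : bsdTriple_of_analyticRank_le_one_of_conductor_lt)
    (h26 : cremona_abs_maninConstant_eq_one_of_level_le) (hGZK : rank_eq_analyticRank_of_analyticRank_le_one)
    (K : Type) [Field K] [NumberField K] (hK : IsImaginaryQuadratic K) (hdK : NumberField.discr K = -7)
    {d : ℤ} (hd : haveI := isGloballyMinimal_92B1; KrizLi2019.InN (⟨0, 0, 0, -1, 1⟩ : WeierstrassCurve ℚ) K d)
    (hsign : haveI := isElliptic_92B1; Int.sign d * jacobiSym ((⟨0, 0, 0, -1, 1⟩ : WeierstrassCurve ℚ).conductorNorm ℤ) d.natAbs = 1)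
    (W₂ : WeierstrassCurve ℚ) [W₂.IsElliptic] [W₂.IsGloballyMinimal]
    (hW₂ : ∃ C : VariableChange ℚ, C • (⟨0, 0, 0, -1, 1⟩ : WeierstrassCurve ℚ).quadraticTwist ((-7 * d : ℤ) : ℚ) = W₂) :
    haveI : Fact (Nat.Prime 2) := ⟨Nat.prime_two⟩
    W₂.analyticRank = 0 ∧ Addv W₂ 2 ∧ 0 ≤ padicValRat 2 W₂.j ∧ ¬ W₂.HasCM ∧ Irr W₂ 2 ∧
      BSDp W₂ 2 ∧ MissingLowerBoundAt W₂ 2 ∧ MissingUpperBoundAt W₂ 2 := by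
  haveI : Fact (Nat.Prime 2) := ⟨Nat.prime_two⟩
  haveI := isElliptic_92B1; haveI := isGloballyMinimal_92B1
  have hr1 := analyticRank_92B1 h33 htab hGZK
  obtain ⟨_, Dt, H, ι, P, j, hopt, hP, hstar⟩ := htab K hK hdK
  have hdK' : ((d * NumberField.discr K : ℤ) : ℚ) = ((-7 * d : ℤ) : ℚ) := by rw [hdK]; push_cast; ring
  have hW₂' : ∃ C : VariableChange ℚ, C • (⟨0, 0, 0, -1, 1⟩ : WeierstrassCurve ℚ).quadraticTwist ((d * NumberField.discr K : ℤ) : ℚ) = W₂ := by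
    rw [hdK']; exact hW₂
  have hB : BSDp W₂ 2 :=
    krizLi_bsdp_two_of_twist_92B1 hKL h33 hS31 h26 K hK hdK Dt hopt H ι P hP j hstar hd hsign W₂ (Or.inr hW₂')
  -- the rank: `r_an(W₁) = r_an(92b1) = 1`, so `r_an(W₂) = 0` (Thm 4.3 at `d`)
  have hd0 : (d : ℚ) ≠ 0 := cast_ne_zero_of_inN _ hd
  obtain ⟨W₁, _, _, hW₁⟩ := exists_globallyMinimal_twist (⟨0, 0, 0, -1, 1⟩ : WeierstrassCurve ℚ) hd0
  obtain ⟨hor, heq⟩ := krizLi_analyticRank_twists _ h33 twoTorsion_92B1 K hK (satisfiesHeegnerHypothesis_92B1 hK.1 hdK) Dt H ι P hP j hstar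
    hd hsign W₁ W₂ hW₁ hW₂'
  have hr2 : W₂.analyticRank = 0 := by omega
  -- the halves
  haveI : Finite W₂.sha := (hGZK W₂ (by rw [hr2]; norm_num)).2
  have hLU := lower_and_upper_of_missingPPartAt W₂ 2 (missingPPartAt_of_bsdp W₂ 2 hB)
  -- the habitat along `−7d ≡ 1 (mod 4)`
  have hdd4 : (-7 * d) % 4 = 1 := by rw [Int.mul_emod, hd.1]; decide
  have hdd0 : (-7 * d : ℤ) ≠ 0 := mul_ne_zero (by norm_num) (Int.natAbs_ne_zero.mp hd.2.1.ne_zero)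
  obtain ⟨hA, hJ, hcmW, hirrW⟩ := habitat_twist_of_addv _ addv_two_92B1 (by rw [padicValRat_j_92B1]; norm_num) not_hasCM_92B1 irr_two_92B1
    hdd4 hdd0 W₂ hW₂
  exact ⟨hr2, hA, hJ, hcmW, hirrW, hB, hLU.1, hLU.2⟩

/-- **THE RANK-ONE MEMBERS `92b1^{(d)}`, BY NAME**: at every global minimal `W₁ ≅ 92b1^{(d)}` (`d ∈ 𝒩(92b1, K)`, `χ_d(−92) = 1`): `r_an(W₁) = 1`,
habitat (`Addv`, `0 ≤ ord₂ j`, `¬CM`, `Irr`) and `BSD(W₁, 2)` — a print-decided RANK-ONE `E[2]`-irreducible additive family (19099's children).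
BSD is not proved by any of this. [cite: KrizLi2019, Thm. 5.1 (2), Thm. 4.3, §6 Table 1 (row 92b1)] [cite: CreutzMiller2012, Thm. 1.1] [cite: Miller2011LMS, Def. 1.1] -/
theorem printFamily92B1_krizLi_rankOneMembers (hKL : KrizLi2019.thm112_bsdTwo_twist) (h33 : KrizLi2019.thm33_rank_twist)
    (htab : KrizLi2019.table1_row92b1) (hS31 : bsdTriple_of_analyticRank_le_one_of_conductor_lt)
    (h26 : cremona_abs_maninConstant_eq_one_of_level_le) (hGZK : rank_eq_analyticRank_of_analyticRank_le_one)
    (K : Type) [Field K] [NumberField K] (hK : IsImaginaryQuadratic K) (hdK : NumberField.discr K = -7)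
    {d : ℤ} (hd : haveI := isGloballyMinimal_92B1; KrizLi2019.InN (⟨0, 0, 0, -1, 1⟩ : WeierstrassCurve ℚ) K d)
    (hsign : haveI := isElliptic_92B1; Int.sign d * jacobiSym ((⟨0, 0, 0, -1, 1⟩ : WeierstrassCurve ℚ).conductorNorm ℤ) d.natAbs = 1)
    (W₁ : WeierstrassCurve ℚ) [W₁.IsElliptic] [W₁.IsGloballyMinimal]
    (hW₁ : ∃ C : VariableChange ℚ, C • (⟨0, 0, 0, -1, 1⟩ : WeierstrassCurve ℚ).quadraticTwist (d : ℚ) = W₁) :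
    haveI : Fact (Nat.Prime 2) := ⟨Nat.prime_two⟩
    W₁.analyticRank = 1 ∧ Addv W₁ 2 ∧ 0 ≤ padicValRat 2 W₁.j ∧ ¬ W₁.HasCM ∧ Irr W₁ 2 ∧ BSDp W₁ 2 := by
  haveI : Fact (Nat.Prime 2) := ⟨Nat.prime_two⟩
  haveI := isElliptic_92B1; haveI := isGloballyMinimal_92B1
  have hr1 := analyticRank_92B1 h33 htab hGZK
  obtain ⟨_, Dt, H, ι, P, j, hopt, hP, hstar⟩ := htab K hK hdK
  have hB : BSDp W₁ 2 := krizLi_bsdp_two_of_twist_92B1 hKL h33 hS31 h26 K hK hdK Dt hopt H ι P hP j hstar hd hsign W₁ (Or.inl hW₁)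
  have hD : (NumberField.discr K : ℚ) ≠ 0 := by exact_mod_cast NumberField.discr_ne_zero K
  have hdK0 : ((d * NumberField.discr K : ℤ) : ℚ) ≠ 0 := by push_cast; exact mul_ne_zero (cast_ne_zero_of_inN _ hd) hD
  obtain ⟨W₂, _, _, hW₂⟩ := exists_globallyMinimal_twist (⟨0, 0, 0, -1, 1⟩ : WeierstrassCurve ℚ) hdK0
  obtain ⟨-, heq⟩ := krizLi_analyticRank_twists _ h33 twoTorsion_92B1 K hK (satisfiesHeegnerHypothesis_92B1 hK.1 hdK) Dt H ι P hP j hstar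
    hd hsign W₁ W₂ hW₁ hW₂
  obtain ⟨hA, hJ, hcmW, hirrW⟩ := habitat_twist_of_addv _ addv_two_92B1 (by rw [padicValRat_j_92B1]; norm_num) not_hasCM_92B1 irr_two_92B1
    hd.1 (Int.natAbs_ne_zero.mp hd.2.1.ne_zero) W₁ hW₁
  exact ⟨by rw [heq, hr1], hA, hJ, hcmW, hirrW, hB⟩

end Road92B1ByName

/-! ## §4 The witness `ℓ = 29`: `#Ẽ(𝔽₂₉) = 37` (`a₂₉ = −7` odd), `29` splits in `ℚ(√−7)`, `χ_{29}(−92) = 1`; members `92b1^{(29)}`, `92b1^{(−203)}` -/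
section Witness92B1

/-- **`ℓ ∈ 𝒮(92b1, K)`** from: `ℓ` prime, `ℓ ∉ {2, 23}`, `(−7/ℓ) = 1`, `a_ℓ(92b1)` odd. [cite: KrizLi2019, Def. 4.1] [cite: Marcus1977, Ch. 3 Thm. 25] -/
theorem inS_92B1 {K : Type} [Field K] [NumberField K] (h2 : Module.finrank ℚ K = 2) (hdK : NumberField.discr K = -7)
    {ℓ : ℕ} (hℓ : ℓ.Prime) (hℓ2 : ℓ ≠ 2) (hℓ23 : ℓ ≠ 23) (hj : jacobiSym (-7) ℓ = 1)
    (hodd : haveI := isGloballyMinimal_92B1; Odd ((⟨0, 0, 0, -1, 1⟩ : WeierstrassCurve ℚ).frobeniusTrace ℓ)) :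
    haveI := isGloballyMinimal_92B1
    KrizLi2019.InS (⟨0, 0, 0, -1, 1⟩ : WeierstrassCurve ℚ) K ℓ := by
  haveI := isElliptic_92B1; haveI := isGloballyMinimal_92B1
  refine ⟨hℓ, ?_, ?_, hodd⟩
  · rw [conductorNorm_92B1]
    intro h
    have h' : ℓ ∣ 2 ^ 3 * 23 := by simpa using h
    rcases (Nat.Prime.dvd_mul hℓ).mp h' with h | h
    · exact hℓ2 ((Nat.prime_dvd_prime_iff_eq hℓ Nat.prime_two).mp (hℓ.dvd_of_dvd_pow h))
    · exact hℓ23 ((Nat.prime_dvd_prime_iff_eq hℓ (by norm_num)).mp h)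
  · rw [Literature.NumberTheory.QuadraticFields.Quadratic.ncard_primesOver_eq_two_iff_jacobiSym h2 hℓ hℓ2, hdK]
    exact hj

/-- **`#Ẽ(𝔽₂₉) = 37` for `92b1`** (certified count; `29 ∤ Δ = −368`), so `a₂₉ = 30 − 37 = −7`. [cite: SilvermanAEC2009, V.2] -/
theorem reductionPointCount_29_92B1 [(⟨0, 0, 0, -1, 1⟩ : WeierstrassCurve ℚ).IsGloballyMinimal] :
    (⟨0, 0, 0, -1, 1⟩ : WeierstrassCurve ℚ).reductionPointCount 29 = 37 := by
  haveI : Fact (Nat.Prime 29) := ⟨by norm_num⟩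
  haveI := isElliptic_92B1
  exact Supersingular.reductionPointCount_eq_of_intModel_countPoints intModel_92B1 29 (by norm_num) (by decide +kernel)
    (by decide +kernel)

/-- **`a₂₉(92b1)` is odd** (`= −7`). [cite: KrizLi2019, Def. 4.1 ("Frob_ℓ of order 3")] -/
theorem odd_frobeniusTrace_29_92B1 [(⟨0, 0, 0, -1, 1⟩ : WeierstrassCurve ℚ).IsGloballyMinimal] :
    Odd ((⟨0, 0, 0, -1, 1⟩ : WeierstrassCurve ℚ).frobeniusTrace 29) := by
  rw [Uniform.U2.odd_frobeniusTrace_iff_odd_reductionPointCount _ (by norm_num : Nat.Prime 29) (by norm_num),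
    reductionPointCount_29_92B1]
  decide

/-- **`29 ∈ 𝒩(92b1, K)`** (`d_K = −7`): `29 ≡ 1 (mod 4)`, `29 ∉ {2, 23}`, `(−7/29) = 1`, `a₂₉` odd. [cite: KrizLi2019, Def. 4.1] -/
theorem inN_29_92B1 {K : Type} [Field K] [NumberField K] (h2 : Module.finrank ℚ K = 2) (hdK : NumberField.discr K = -7) :
    haveI := isGloballyMinimal_92B1
    KrizLi2019.InN (⟨0, 0, 0, -1, 1⟩ : WeierstrassCurve ℚ) K 29 := by
  haveI := isGloballyMinimal_92B1
  have h29 : Nat.Prime 29 := by norm_num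
  have hna : (29 : ℤ).natAbs = 29 := rfl
  refine ⟨by decide, by rw [hna]; exact h29.squarefree, fun ℓ hℓ hℓd => ?_⟩
  rw [hna] at hℓd
  obtain rfl := (Nat.prime_dvd_prime_iff_eq hℓ h29).mp hℓd
  exact inS_92B1 h2 hdK h29 (by norm_num) (by norm_num) (by norm_num) odd_frobeniusTrace_29_92B1

/-- **`χ_{29}(−92) = 1`**: `sgn(29)·(92/29) = (5/29) = 1`, read with `N = 92` exact. [cite: KrizLi2019, Thm. 5.1 (2) condition "χ_d(−N) = 1"] -/
theorem sign_29_92B1 :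
    haveI := isElliptic_92B1
    Int.sign 29 * jacobiSym ((⟨0, 0, 0, -1, 1⟩ : WeierstrassCurve ℚ).conductorNorm ℤ) (29 : ℤ).natAbs = 1 := by
  rw [conductorNorm_92B1, show (29 : ℤ).natAbs = 29 from rfl]; norm_num

/-- **The C3″ member `92b1^{(−203)}`** (`−203 = (−7)·29`; rank `0`, `E[2]`-irreducible, additive potentially good, non-CM): `BSD(·, 2)` and BOTH
K4 halves at every global minimal model, BY NAME (`K` any quadratic field with `d_K = −7`). The `92b1` road is not vacuous. BSD is not proved by any
of this. [cite: KrizLi2019, Thm. 5.1 (2), Thm. 4.3, §6 Table 1 (row 92b1)] [cite: CreutzMiller2012, Thm. 1.1] [cite: Miller2011LMS, Def. 1.1] -/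
theorem printFamily92B1_krizLi_witness_neg203 (hKL : KrizLi2019.thm112_bsdTwo_twist) (h33 : KrizLi2019.thm33_rank_twist)
    (htab : KrizLi2019.table1_row92b1) (hS31 : bsdTriple_of_analyticRank_le_one_of_conductor_lt)
    (h26 : cremona_abs_maninConstant_eq_one_of_level_le) (hGZK : rank_eq_analyticRank_of_analyticRank_le_one)
    (K : Type) [Field K] [NumberField K] (hK : IsImaginaryQuadratic K) (hdK : NumberField.discr K = -7)
    (W₂ : WeierstrassCurve ℚ) [W₂.IsElliptic] [W₂.IsGloballyMinimal]
    (hW₂ : ∃ C : VariableChange ℚ, C • (⟨0, 0, 0, -1, 1⟩ : WeierstrassCurve ℚ).quadraticTwist ((-203 : ℤ) : ℚ) = W₂) :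
    haveI : Fact (Nat.Prime 2) := ⟨Nat.prime_two⟩
    W₂.analyticRank = 0 ∧ Addv W₂ 2 ∧ 0 ≤ padicValRat 2 W₂.j ∧ ¬ W₂.HasCM ∧ Irr W₂ 2 ∧
      BSDp W₂ 2 ∧ MissingLowerBoundAt W₂ 2 ∧ MissingUpperBoundAt W₂ 2 :=
  printFamily92B1_krizLi_rankZeroCompanions hKL h33 htab hS31 h26 hGZK K hK hdK (inN_29_92B1 hK.1 hdK) sign_29_92B1 W₂
    (by rw [show ((-7 * 29 : ℤ) : ℚ) = ((-203 : ℤ) : ℚ) by norm_num]; exact hW₂)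

/-- **The rank-one member `92b1^{(29)}`**: `r_an = 1 ∧ habitat ∧ BSD(·, 2)` at every global minimal model. BSD is not proved by any of this.
[cite: KrizLi2019, Thm. 5.1 (2), Thm. 4.3, §6 Table 1 (row 92b1)] [cite: CreutzMiller2012, Thm. 1.1] [cite: Miller2011LMS, Def. 1.1] -/
theorem printFamily92B1_krizLi_witness29 (hKL : KrizLi2019.thm112_bsdTwo_twist) (h33 : KrizLi2019.thm33_rank_twist)
    (htab : KrizLi2019.table1_row92b1) (hS31 : bsdTriple_of_analyticRank_le_one_of_conductor_lt)
    (h26 : cremona_abs_maninConstant_eq_one_of_level_le) (hGZK : rank_eq_analyticRank_of_analyticRank_le_one)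
    (K : Type) [Field K] [NumberField K] (hK : IsImaginaryQuadratic K) (hdK : NumberField.discr K = -7)
    (W₁ : WeierstrassCurve ℚ) [W₁.IsElliptic] [W₁.IsGloballyMinimal]
    (hW₁ : ∃ C : VariableChange ℚ, C • (⟨0, 0, 0, -1, 1⟩ : WeierstrassCurve ℚ).quadraticTwist ((29 : ℤ) : ℚ) = W₁) :
    haveI : Fact (Nat.Prime 2) := ⟨Nat.prime_two⟩
    W₁.analyticRank = 1 ∧ Addv W₁ 2 ∧ 0 ≤ padicValRat 2 W₁.j ∧ ¬ W₁.HasCM ∧ Irr W₁ 2 ∧ BSDp W₁ 2 :=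
  printFamily92B1_krizLi_rankOneMembers hKL h33 htab hS31 h26 hGZK K hK hdK (inN_29_92B1 hK.1 hdK) sign_29_92B1 W₁ hW₁

end Witness92B1

end Summit.BirchSwinnertonDyer.BirchSwinnertonDyer.Theorems.AddPotGoodPrint

end
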